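import Mathlib
import Summits.MatrixMultiplication.MatrixMultiplication.Theses.GroupTheoreticSTPP
import Literature.Computability.AlgebraicComplexity.PrattTrapezoidValSDPP

set_option linter.dupNamespace false

/-!
# Stub `stub_packingToCThesis` — two families certify X_C (`CPackingConstruction → CThesis`)

Crux `stmt-MatrixMultiplication-10595` (`Theses.ThinBlockAlpha.ThinPackings`), line
`two-families-salem-spencer`, registered stub `stub_packingToCThesis : CPackingConstruction → CThesis`
(siege k2, variation: explicit / elementary route).

THE ARGUMENT (Cohn–Kleinberg–Szegedy–Umans 2005, §4 and §6.2; Pratt 2024, proof of Thm. 4.7), with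
every constant explicit.  Fix `ε > 0` and put `e := min ε 1`, `δ := e / 10`, `η := e / 2`, and the
EXPONENT GAP `g := 2ε − η − 5δ − δε ≥ 9ε/10 > 0`.  Take `n` so large that `64 < n ^ g` and that a
corner-free index configuration `j₁ j₂ j₃ : ι₀ → Fin n` with `n ^ (2 − η) ≤ 64 |ι₀|` exists
(`exists_cornerFree_indexMaps_card_ge`, Behrend), and an SDPP design `(A i, B i)_{i < n}` in a finite
abelian group `H` with `|H| ≤ n ^ (2 + δ)` and `|A i| |B i| ≥ n ^ (2 − δ)` (the hypothesis
`CPackingConstruction`, CKSU Conj. 4.7).  The CKSU triangle lift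
`Â_x = A (j₁ x) × {0} × B (j₃ x)`, `B̂_x = B (j₁ x) × A (j₂ x) × {0}`, `Ĉ_x = {0} × B (j₂ x) × A (j₃ x)`
is an STPP family in `H³` (`addSimultaneousTPP_of_sdpp`), re-indexed by `Fin |ι₀|`; each block has
volume `∏_t |A (j_t x)| |B (j_t x)| ≥ n ^ (3 (2 − δ))`, so
`Σ_x vol_x ^ ((2+ε)/3) ≥ |ι₀| · n ^ ((2−δ)(2+ε)) ≥ n ^ (2−η+(2−δ)(2+ε)) / 64 = n ^ (3(2+δ)) · n ^ g / 64
 > n ^ (3(2+δ)) ≥ |H|³ = |H³|` — the inequality of `CThesis`.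

The real-exponent bookkeeping is isolated in `PackingToCThesisK2.sum_rpow_gt` (pure `Real.rpow`
arithmetic over an arbitrary finite index type, so no re-indexing of sums is needed), the re-indexed
one-clause STPP in `PackingToCThesisK2.lift_isSTPP`.  Everything lives in the sub-namespace
`…Theorems.ThinPackings.PackingToCThesisK2` (an independent second proof of the registered stub; the
name `…Theorems.ThinPackings.stub_packingToCThesis` is taken by `ThinBlockAlphaThinPackingsStubPackingToCThesis`).
-/

namespace Summit.MatrixMultiplication.MatrixMultiplication.Theorems.ThinPackings

open Summit.MatrixMultiplication.MatrixMultiplication.Theses.GroupTheoreticSTPP (CPackingConstruction CThesis)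
open Finset Literature.Combinatorics.Additive Literature.Computability.AlgebraicComplexity

namespace PackingToCThesisK2

/-- **Exponent bookkeeping of the triangle lift.**  With the gap `g = 2ε − η − 5δ − δε`, `64 < n ^ g`,
an index type of size `≥ n ^ (2 − η) / 64`, a host of size `cardH ≤ n ^ (2 + δ)` and block volumes
`V i ≥ (n ^ (2 − δ)) ^ 3`, one has `cardH ^ 3 < Σ_i V i ^ ((2 + ε) / 3)`. -/
theorem sum_rpow_gt {ι : Type*} [Fintype ι] {n : ℕ} (hn : 0 < n) {ε δ η g : ℝ} (hε : 0 < ε)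
    (hg : g = 2 * ε - η - 5 * δ - δ * ε) (h64 : 64 < (n : ℝ) ^ g)
    (hcard : (n : ℝ) ^ (2 - η) ≤ 64 * Fintype.card ι)
    {cardH : ℕ} (hH : (cardH : ℝ) ≤ (n : ℝ) ^ (2 + δ))
    (V : ι → ℝ) (hV : ∀ i, ((n : ℝ) ^ (2 - δ)) ^ 3 ≤ V i) :
    (cardH : ℝ) ^ 3 < ∑ i, V i ^ ((2 + ε) / 3) := by
  have hn0 : (0 : ℝ) < n := by exact_mod_cast hn
  set p : ℝ := (2 + ε) / 3 with hp
  have hp0 : 0 < p := by positivity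
  have hcube : ((n : ℝ) ^ (2 - δ)) ^ 3 = (n : ℝ) ^ (3 * (2 - δ)) := by
    rw [show (3 : ℝ) * (2 - δ) = (2 - δ) * ((3 : ℕ) : ℝ) by push_cast; ring,
      Real.rpow_mul_natCast hn0.le]
  -- each block contributes at least `n ^ ((2 - δ) (2 + ε))`
  have hterm : ∀ i, (n : ℝ) ^ ((2 - δ) * (2 + ε)) ≤ V i ^ p := by
    intro i
    have h0 : 0 ≤ (n : ℝ) ^ (3 * (2 - δ)) := by positivity
    have hle : (n : ℝ) ^ (3 * (2 - δ)) ≤ V i := hcube ▸ hV i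
    calc (n : ℝ) ^ ((2 - δ) * (2 + ε)) = ((n : ℝ) ^ (3 * (2 - δ))) ^ p := by
          rw [← Real.rpow_mul hn0.le]; congr 1; rw [hp]; ring
      _ ≤ V i ^ p := Real.rpow_le_rpow h0 hle hp0.le
  have hsum : (Fintype.card ι : ℝ) * (n : ℝ) ^ ((2 - δ) * (2 + ε)) ≤ ∑ i, V i ^ p := by
    calc (Fintype.card ι : ℝ) * (n : ℝ) ^ ((2 - δ) * (2 + ε))
          = ∑ _i : ι, (n : ℝ) ^ ((2 - δ) * (2 + ε)) := by
          rw [Finset.sum_const, nsmul_eq_mul, Finset.card_univ]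
      _ ≤ ∑ i, V i ^ p := Finset.sum_le_sum fun i _ => hterm i
  -- the host
  have hH3 : (cardH : ℝ) ^ 3 ≤ (n : ℝ) ^ (3 * (2 + δ)) := by
    calc (cardH : ℝ) ^ 3 ≤ ((n : ℝ) ^ (2 + δ)) ^ 3 := by gcongr
      _ = (n : ℝ) ^ (3 * (2 + δ)) := by
          rw [show (3 : ℝ) * (2 + δ) = (2 + δ) * ((3 : ℕ) : ℝ) by push_cast; ring,
            Real.rpow_mul_natCast hn0.le]
  -- the chain, multiplied through by `64`
  have key : 64 * (cardH : ℝ) ^ 3 < 64 * ∑ i, V i ^ p := by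
    calc 64 * (cardH : ℝ) ^ 3 ≤ 64 * (n : ℝ) ^ (3 * (2 + δ)) := by gcongr
      _ < (n : ℝ) ^ g * (n : ℝ) ^ (3 * (2 + δ)) := by gcongr
      _ = (n : ℝ) ^ (2 - η) * (n : ℝ) ^ ((2 - δ) * (2 + ε)) := by
          rw [← Real.rpow_add hn0, ← Real.rpow_add hn0]; congr 1; rw [hg]; ring
      _ ≤ (64 * Fintype.card ι) * (n : ℝ) ^ ((2 - δ) * (2 + ε)) := by gcongr
      _ = 64 * ((Fintype.card ι : ℝ) * (n : ℝ) ^ ((2 - δ) * (2 + ε))) := by ring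
      _ ≤ 64 * ∑ i, V i ^ p := by gcongr
  linarith

/-- **The re-indexed CKSU triangle lift is an STPP family, in the one-clause (BCCGNSU Def. 2.2) form
inlined in `CThesis`.**  For SDPP pairs `(A i, B i)_{i<n}`, corner-free index maps `j₁ j₂ j₃ : ι₀ → Fin n`
and any injective re-indexing `e : Fin N → ι₀`, the triples
`(A (j₁ (e i)) × {0} × B (j₃ (e i)), B (j₁ (e i)) × A (j₂ (e i)) × {0}, {0} × B (j₂ (e i)) × A (j₃ (e i)))`
satisfy: `(s' − s) + (t' − t) + (u' − u) = 0` forces `i = j = k`, `s = s'`, `t = t'`, `u = u'`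
(`addSimultaneousTPP_of_sdpp` + `addSimultaneousTPP_iff_forall`, transported along `e`). -/
theorem lift_isSTPP {H : Type*} [AddCommGroup H] {n : ℕ} {A B : Fin n → Finset H}
    (hD : ∀ i : Fin n, ∀ a ∈ A i, ∀ a' ∈ A i, ∀ b ∈ B i, ∀ b' ∈ B i,
      (a - a') + (b - b') = 0 → a = a' ∧ b = b')
    (hSD : ∀ i j k : Fin n, ∀ a ∈ A i, ∀ a' ∈ A j, ∀ b ∈ B j, ∀ b' ∈ B k,
      (a - a') + (b - b') = 0 → i = k)
    {ι₀ : Type*} (j₁ j₂ j₃ : ι₀ → Fin n)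
    (hcf : ∀ x y z : ι₀, j₁ x = j₁ z → j₂ y = j₂ x → j₃ z = j₃ y → x = y ∧ y = z)
    {N : ℕ} {e : Fin N → ι₀} (he : Function.Injective e) :
    ∀ i j k : Fin N,
      ∀ s ∈ A (j₁ (e k)) ×ˢ (({0} : Finset H) ×ˢ B (j₃ (e k))),
      ∀ s' ∈ A (j₁ (e i)) ×ˢ (({0} : Finset H) ×ˢ B (j₃ (e i))),
      ∀ t ∈ B (j₁ (e i)) ×ˢ (A (j₂ (e i)) ×ˢ ({0} : Finset H)),
      ∀ t' ∈ B (j₁ (e j)) ×ˢ (A (j₂ (e j)) ×ˢ ({0} : Finset H)),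
      ∀ u ∈ ({0} : Finset H) ×ˢ (B (j₂ (e j)) ×ˢ A (j₃ (e j))),
      ∀ u' ∈ ({0} : Finset H) ×ˢ (B (j₂ (e k)) ×ˢ A (j₃ (e k))),
      (s' - s) + (t' - t) + (u' - u) = 0 → i = j ∧ j = k ∧ s = s' ∧ t = t' ∧ u = u' := by
  have hST := (addSimultaneousTPP_iff_forall _ _ _).1
    (addSimultaneousTPP_of_sdpp hD hSD j₁ j₂ j₃ hcf)
  intro i j k s hs s' hs' t ht t' ht' u hu u' hu' hrel
  obtain ⟨h1, h2, h3, h4, h5⟩ :=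
    hST (e i) (e j) (e k) s hs s' hs' t ht t' ht' u hu u' hu' hrel
  exact ⟨he h1, he h2, h3, h4, h5⟩

/-- **stub_packingToCThesis** — TWO FAMILIES CERTIFY X_C.  CKSU Conjecture 4.7 (the tree constant
`GroupTheoreticSTPP.CPackingConstruction`: for every `δ > 0` and `n₀`, some `n ≥ n₀` SDPP pairs
`(A i, B i)_{i<n}` in a finite abelian group `H` with `|H| ≤ n^{2+δ}`, `|A i||B i| ≥ n^{2−δ}`) implies
`GroupTheoreticSTPP.CThesis` (X_C: for every `ε > 0` an abelian STPP family with
`Σ_i (|A i||B i||C i|)^{(2+ε)/3} > |H|`): the CKSU triangle lift over a Behrend corner-free index set,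
with `δ = min ε 1 / 10`, `η = min ε 1 / 2`, gap `g = 2ε − η − 5δ − δε ≥ 9ε/10`.
[cite: CohnKleinbergSzegedyUmans2005, §4 and §6.2] [cite: Pratt2024, Thm. 4.7 (proof)] -/
theorem stub_packingToCThesis : CPackingConstruction → CThesis := by
  intro hP
  unfold CThesis
  intro ε hε
  unfold CPackingConstruction at hP
  -- the parameters
  set e : ℝ := min ε 1 with he_def
  have he0 : 0 < e := lt_min hε one_pos
  have he1 : e ≤ 1 := min_le_right _ _
  have heε : e ≤ ε := min_le_left _ _
  set δ : ℝ := e / 10 with hδ_def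
  set η : ℝ := e / 2 with hη_def
  have hδ0 : 0 < δ := by positivity
  have hη0 : 0 < η := by positivity
  have hη1 : η ≤ 1 := by linarith
  set g : ℝ := 2 * ε - η - 5 * δ - δ * ε with hg_def
  have heε' : e * ε ≤ ε := mul_le_of_le_one_left hε.le he1
  have hg9 : 9 * ε / 10 ≤ g := by
    rw [hg_def, hη_def, hδ_def]; linarith
  have hg0 : 0 < g := by linarith
  -- thresholds: corner-free index sets (Behrend) and `64 < n ^ g`
  obtain ⟨n₁, hn₁⟩ := exists_cornerFree_indexMaps_card_ge η hη0 hη1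
  obtain ⟨n₂, hn₂⟩ : ∃ n₂ : ℕ, ∀ b ≥ n₂, (64 : ℝ) < (b : ℝ) ^ g :=
    Filter.eventually_atTop.1
      (((tendsto_rpow_atTop hg0).comp tendsto_natCast_atTop_atTop).eventually_gt_atTop 64)
  -- the SDPP design
  obtain ⟨n, hn, H, _instG, _instF, A, B, hD, hSD, hcardH, hvol⟩ :=
    hP δ hδ0 (max (max n₁ n₂) 1)
  have hnn₁ : n₁ ≤ n := le_trans (le_trans (le_max_left _ _) (le_max_left _ _)) hn
  have hnn₂ : n₂ ≤ n := le_trans (le_trans (le_max_right _ _) (le_max_left _ _)) hn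
  have hn1 : 0 < n := lt_of_lt_of_le (lt_of_lt_of_le one_pos (le_max_right _ _)) hn
  have h64 : (64 : ℝ) < (n : ℝ) ^ g := hn₂ n hnn₂
  -- the corner-free index configuration
  obtain ⟨ι₀, _instFι, _instDι, j₁, j₂, j₃, hcardι, hcf⟩ := hn₁ n hnn₁
  -- the lift in `H × H × H`, re-indexed by `Fin |ι₀|`
  set N : ℕ := Fintype.card ι₀ with hN
  set eqv : Fin N ≃ ι₀ := (Fintype.equivFin ι₀).symm with heqv
  refine ⟨H × H × H, inferInstance, inferInstance, N,
    fun i => A (j₁ (eqv i)) ×ˢ (({0} : Finset H) ×ˢ B (j₃ (eqv i))),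
    fun i => B (j₁ (eqv i)) ×ˢ (A (j₂ (eqv i)) ×ˢ ({0} : Finset H)),
    fun i => ({0} : Finset H) ×ˢ (B (j₂ (eqv i)) ×ˢ A (j₃ (eqv i))),
    lift_isSTPP hD hSD j₁ j₂ j₃ hcf eqv.injective, ?_⟩
  -- the count
  have hcard3 : (Fintype.card (H × H × H) : ℝ) = ((Fintype.card H : ℕ) : ℝ) ^ 3 := by
    simp only [Fintype.card_prod]; push_cast; ring
  rw [hcard3]
  have hcardN : (n : ℝ) ^ (2 - η) ≤ 64 * Fintype.card (Fin N) := by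
    rw [Fintype.card_fin]; exact hcardι
  refine sum_rpow_gt hn1 hε hg_def h64 hcardN hcardH _ fun i => ?_
  -- block volumes: `|Â| |B̂| |Ĉ| = ∏_t |A (j_t x)| |B (j_t x)| ≥ (n ^ (2 - δ)) ^ 3`
  rw [card_mul_card_mul_card_sdpp j₁ j₂ j₃ (eqv i)]
  have h1 := hvol (j₁ (eqv i))
  have h2 := hvol (j₂ (eqv i))
  have h3 := hvol (j₃ (eqv i))
  have h0 : 0 ≤ (n : ℝ) ^ (2 - δ) := by positivity
  push_cast at h1 h2 h3 ⊢
  calc ((n : ℝ) ^ (2 - δ)) ^ 3 = (n : ℝ) ^ (2 - δ) * (n : ℝ) ^ (2 - δ) * (n : ℝ) ^ (2 - δ) := by ring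
    _ ≤ (#(A (j₁ (eqv i))) * #(B (j₁ (eqv i)))) * (#(A (j₂ (eqv i))) * #(B (j₂ (eqv i)))) *
          (#(A (j₃ (eqv i))) * #(B (j₃ (eqv i)))) :=
        mul_le_mul (mul_le_mul h1 h2 h0 (by positivity)) h3 h0 (by positivity)

end PackingToCThesisK2

end Summit.MatrixMultiplication.MatrixMultiplication.Theorems.ThinPackings
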